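import Summits.CriticalPhenomena.PercolationContinuityZ3.Theorems.Transplant.PlanarSkeletonFrmFromDefs
import Summits.CriticalPhenomena.PercolationContinuityZ3.Theorems.Transplant.SkelFrmFromBChoiceDepth
import Summits.CriticalPhenomena.PercolationContinuityZ3.Theorems.Transplant.SkelFrmBChoiceDepth
import Summits.CriticalPhenomena.PercolationContinuityZ3.Theorems.Transplant.SkelFrmFromBChoiceLinks
import Summits.CriticalPhenomena.PercolationContinuityZ3.Theorems.Transplant.SkelFrmBChoiceLinks
import Summits.CriticalPhenomena.PercolationContinuityZ3.Theorems.Transplant.SkelFrmFromBParamsSlotsT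
import Summits.CriticalPhenomena.PercolationContinuityZ3.Theorems.Transplant.SkelFrmBParamsSlotsT
import HarnessLib
import Summits.CriticalPhenomena.PercolationContinuityZ3.Theorems.Transplant.SkelFrmBChoiceResidC
/-!
# U-WAVE PORT (RULING D-U, lead g21 2026-08-26; WAVE-U-MANIFEST v3.0 row «SkelFrmBChoiceResidC» ↦ «SkelFrmFromBChoiceResidC») of the tree module
# `Transplant/SkelFrmBChoiceResidC` onto the carrier `PlanarSkeletonFrmFrom` (frames only, cylinders connected from width `ℓ₀` on)

ORIGINAL TITLE: N2 (frames-only node `SamePDropOfSkeletonFrm₁`, OPEN) — (ζ″) ledger: THE (C)-COLUMN RESIDUAL SLOT FUNCTIONS `NegB.gxC / fxC / exC` AND THEIR FLOOR LEMMAS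

builds on p205010 (kernel theorem, internal audit signed; external expert review pending) — nothing in this file uses p205010; NOTHING is claimed about the
OPEN node U `SamePDropOfSkeletonFrmFrom₁` (nor U_s / the end state).  Lane `prim-bschramm`, seat `prim-hp-8 gen 53 (U-wave port pen, family P-hp8; tool of record = p3-g26 port_u.py)`; helper file
(`--supports stmt-CriticalPhenomena-4575 --as helper`).  PORT RULES r1–r4 of RULING D-U: declaration order and proof texts are those of the original,
byte-identical except (i) the carrier token `PlanarSkeletonFrm ↦ PlanarSkeletonFrmFrom` (binders, `namespace`/`end` lines, qualified names of twinned
declarations), (ii) carrier-FREE declarations of the original (φ-level `Skelφ…` blocks and namespace-only arithmetic residents) are NOT re-declared —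
this file imports the original and `export`s the twin-free residents (POLICY T / treatment (m1)); residents whose statement mentions a twinned
constant are copied, (iii) every carrier-binding declaration keeps its explicit binder `(Φ : PlanarSkeletonFrmFrom G)` in its own signature (r2).  Docstrings and citations are the original's.  Manifest row idx 97 (level 13; flags verbatim|DEF-ROW); filed by the hp-8 lineage under RULING M-11 (family P-hp8).
-/

open scoped Classical

noncomputable section

namespace Summit.CriticalPhenomena.PercolationContinuityZ3.Theorems.Transplant

namespace PlanarSkeletonFrmFrom

namespace NegB

open Literature.Probability.Percolation Literature.Probability.LatticeModels SimpleGraph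
open SkelConc (Consts)
open Skelφ.StepI (DataNS OutNS)
open Neg

/-! ## §1 The kit-prism radius read at `(D, g, f)` -/

section RLD

variable (κ : Consts) {V : Type} [DecidableEq V] [Countable V] {G : SimpleGraph V} [G.LocallyFinite] (Φ : PlanarSkeletonFrmFrom G) (t : V) (p : unitInterval)

/-- **p3-g16's long link region's prism radius `RL`, read at `(D, g, f)`** (so that it is a floor on the excess slot `ex : GSlot`). [this work] -/
def RLD (κ : Consts) {V : Type} [DecidableEq V] [Countable V] {G : SimpleGraph V} [G.LocallyFinite] (Φ : PlanarSkeletonFrmFrom G) (t : V) (p : unitInterval) (D : DataNS V) (g f : ℕ) : ℕ := D.R (D.toDataN.scale t (ML κ Φ t p D g) (nL κ Φ t p D g f))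

/-- `RL κ Φ t p O gv fv = RLD κ Φ t p O.merged (gOf …) (fOf …)` (by `rfl`). [folklore] -/
theorem RL_eq_RLD (κ : Consts) {V : Type} [DecidableEq V] [Countable V] {G : SimpleGraph V} [G.LocallyFinite] (Φ : PlanarSkeletonFrmFrom G) (t : V) (p : unitInterval) (O : OutNS V) (gv fv : Neg.FSlot) : RL κ Φ t p O gv fv = RLD κ Φ t p O.merged (gOf κ Φ t p O gv) (fOf κ Φ t p O fv) := rfl

end RLD

/-! ## §2 The (C)-column residual slot functions -/

/-- **The (C)-column BOX residual** `gxC mk := max {gFloorKG, 40·K·R′0, 22000·Kq·(R′0+2)}`. [this work] -/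
def gxC (mk : ℕ) : Neg.FSlot := fun κ _ _ _ _ _ Φ t p D =>
  max (gFloorKG κ Φ t p D mk) (max (40 * Neg.K κ * KS0.R'0 κ Φ t p D mk) (22000 * Neg.Kq κ * (KS0.R'0 κ Φ t p D mk + 2)))

/-- **The (C)-column WIDTH residual** `fxC mk := 2000·Kq·(R′0+2)`. [this work] -/
def fxC (mk : ℕ) : Neg.FSlot := fun κ _ _ _ _ _ Φ t p D => 2000 * Neg.Kq κ * (KS0.R'0 κ Φ t p D mk + 2)

/-- **The (C)-column EXCESS residual** `exC mk := max {KS0.r₀0 t D mk (RLD …) + 3, ZD + 4}`. [this work] -/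
def exC (mk : ℕ) : GSlot := fun κ _ _ _ _ _ Φ t p D g f => max (KS0.r₀0 t D mk (RLD κ Φ t p D g f) + 3) (ZD κ Φ t p D g f + 4)

section Floors

variable (κ : Consts) {V : Type} [DecidableEq V] [Countable V] {G : SimpleGraph V} [G.LocallyFinite] (Φ : PlanarSkeletonFrmFrom G) (t : V) (p : unitInterval)
  (D : DataNS V) (g f mk : ℕ)

/-- `gxC` by name. [folklore] -/
theorem gxC_at (κ : Consts) {V : Type} [DecidableEq V] [Countable V] {G : SimpleGraph V} [G.LocallyFinite] (Φ : PlanarSkeletonFrmFrom G) (t : V) (p : unitInterval) (D : DataNS V) (mk : ℕ) : gxC mk κ Φ t p D = max (gFloorKG κ Φ t p D mk) (max (40 * Neg.K κ * KS0.R'0 κ Φ t p D mk) (22000 * Neg.Kq κ * (KS0.R'0 κ Φ t p D mk + 2))) := rfl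

/-- `fxC` by name. [folklore] -/
theorem fxC_at (κ : Consts) {V : Type} [DecidableEq V] [Countable V] {G : SimpleGraph V} [G.LocallyFinite] (Φ : PlanarSkeletonFrmFrom G) (t : V) (p : unitInterval) (D : DataNS V) (mk : ℕ) : fxC mk κ Φ t p D = 2000 * Neg.Kq κ * (KS0.R'0 κ Φ t p D mk + 2) := rfl

/-- `exC` by name. [folklore] -/
theorem exC_at (κ : Consts) {V : Type} [DecidableEq V] [Countable V] {G : SimpleGraph V} [G.LocallyFinite] (Φ : PlanarSkeletonFrmFrom G) (t : V) (p : unitInterval) (D : DataNS V) (g : ℕ) (f : ℕ) (mk : ℕ) : exC mk κ Φ t p D g f = max (KS0.r₀0 t D mk (RLD κ Φ t p D g f) + 3) (ZD κ Φ t p D g f + 4) := rfl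

/-- **The three box floors inside `gxC`.** [folklore] -/
theorem gxC_floors (κ : Consts) {V : Type} [DecidableEq V] [Countable V] {G : SimpleGraph V} [G.LocallyFinite] (Φ : PlanarSkeletonFrmFrom G) (t : V) (p : unitInterval) (D : DataNS V) (mk : ℕ) : gFloorKG κ Φ t p D mk ≤ gxC mk κ Φ t p D ∧ 40 * Neg.K κ * KS0.R'0 κ Φ t p D mk ≤ gxC mk κ Φ t p D ∧
    22000 * Neg.Kq κ * (KS0.R'0 κ Φ t p D mk + 2) ≤ gxC mk κ Φ t p D := by
  refine ⟨?_, ?_, ?_⟩ <;> rw [gxC_at] <;> omega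

/-- **The two excess floors inside `exC`.** [folklore] -/
theorem exC_floors (κ : Consts) {V : Type} [DecidableEq V] [Countable V] {G : SimpleGraph V} [G.LocallyFinite] (Φ : PlanarSkeletonFrmFrom G) (t : V) (p : unitInterval) (D : DataNS V) (g : ℕ) (f : ℕ) (mk : ℕ) : KS0.r₀0 t D mk (RLD κ Φ t p D g f) + 3 ≤ exC mk κ Φ t p D g f ∧ ZD κ Φ t p D g f + 4 ≤ exC mk κ Φ t p D g f := by
  refine ⟨?_, ?_⟩ <;> rw [exC_at] <;> omega

/-- The width floor inside `fxC` (equality). [folklore] -/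
theorem fxC_floor (κ : Consts) {V : Type} [DecidableEq V] [Countable V] {G : SimpleGraph V} [G.LocallyFinite] (Φ : PlanarSkeletonFrmFrom G) (t : V) (p : unitInterval) (D : DataNS V) (mk : ℕ) : 2000 * Neg.Kq κ * (KS0.R'0 κ Φ t p D mk + 2) ≤ fxC mk κ Φ t p D := le_of_eq (fxC_at κ Φ t p D mk).symm

end Floors

/-! ## §3 Transfer to any dominating slot value (the node file's `gxQ/fxQ/exQ ⊒ gxC/fxC/exC`) -/

section Transfer

variable {κ : Consts} {V : Type} [DecidableEq V] [Countable V] {G : SimpleGraph V} [G.LocallyFinite] {Φ : PlanarSkeletonFrmFrom G} {t : V} {p : unitInterval} {mk : ℕ}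

/-- **HX's `Hg`** from any box slot value dominating `gxC`. [folklore] -/
theorem Hg_of_ge {κ : Consts} {V : Type} [DecidableEq V] [Countable V] {G : SimpleGraph V} [G.LocallyFinite] {Φ : PlanarSkeletonFrmFrom G} {t : V} {p : unitInterval} {mk : ℕ} {gv : Neg.FSlot} (h : ∀ D : DataNS V, gxC mk κ Φ t p D ≤ gv κ Φ t p D) (D : DataNS V) :
    gFloorKG κ Φ t p D mk ≤ gv κ Φ t p D ∧ 40 * Neg.K κ * KS0.R'0 κ Φ t p D mk ≤ gv κ Φ t p D :=
  ⟨(gxC_floors κ Φ t p D mk).1.trans (h D), (gxC_floors κ Φ t p D mk).2.1.trans (h D)⟩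

/-- **HX's `Hex`** from any excess slot value dominating `exC`. [folklore] -/
theorem Hex_of_ge {κ : Consts} {V : Type} [DecidableEq V] [Countable V] {G : SimpleGraph V} [G.LocallyFinite] {Φ : PlanarSkeletonFrmFrom G} {t : V} {p : unitInterval} {mk : ℕ} {ex : GSlot} (h : ∀ (D : DataNS V) (g f : ℕ), exC mk κ Φ t p D g f ≤ ex κ Φ t p D g f) (D : DataNS V) (g f : ℕ) :
    KS0.r₀0 t D mk (RLD κ Φ t p D g f) + 3 ≤ ex κ Φ t p D g f ∧ ZD κ Φ t p D g f + 4 ≤ ex κ Φ t p D g f :=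
  ⟨(exC_floors κ Φ t p D g f mk).1.trans (h D g f), (exC_floors κ Φ t p D g f mk).2.trans (h D g f)⟩

/-- **J19 `hR0`**: `22000·(R′0+2) ≤ M_L (KS.gT mk gx)` from any box residual dominating `gxC` (`gx ≤ gT ≤ M_L`). [folklore] -/
theorem hR0_of_ge {κ : Consts} {V : Type} [DecidableEq V] [Countable V] {G : SimpleGraph V} [G.LocallyFinite] {Φ : PlanarSkeletonFrmFrom G} {t : V} {p : unitInterval} {mk : ℕ} {gx : Neg.FSlot} (h : ∀ D : DataNS V, gxC mk κ Φ t p D ≤ gx κ Φ t p D) (D : DataNS V) :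
    22000 * (KS0.R'0 κ Φ t p D mk + 2) ≤ ML κ Φ t p D (KS.gT mk gx κ Φ t p D) ∧
      22000 * Neg.Kq κ * (KS0.R'0 κ Φ t p D mk + 2) ≤ ML κ Φ t p D (KS.gT mk gx κ Φ t p D) := by
  have h1 := (gxC_floors κ Φ t p D mk).2.2.trans ((h D).trans ((KS.gT_floors κ Φ t p D mk gx).2.2.2.trans (ML_le_ML κ Φ t p D _).2))
  have hKq := Neg.one_le_Kq κ
  refine ⟨le_trans ?_ h1, h1⟩
  calc 22000 * (KS0.R'0 κ Φ t p D mk + 2) = 22000 * 1 * (KS0.R'0 κ Φ t p D mk + 2) := by ring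
    _ ≤ 22000 * Neg.Kq κ * (KS0.R'0 κ Φ t p D mk + 2) := by gcongr

/-- **J19 `hℓA`**: `22000·Kq·(R′0+2) ≤ ℓ_L` at the box slot `KS.gT mk gx`, under the numeric long clause (`M_L + 1 ≤ ℓ_L`). [folklore] -/
theorem hℓA_of_ge {κ : Consts} {V : Type} [DecidableEq V] [Countable V] {G : SimpleGraph V} [G.LocallyFinite] {Φ : PlanarSkeletonFrmFrom G} {t : V} {p : unitInterval} {mk : ℕ} {gx : Neg.FSlot} (h : ∀ D : DataNS V, gxC mk κ Φ t p D ≤ gx κ Φ t p D) (D : DataNS V) {f : ℕ}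
    (hN : EqNumL κ Φ t p D (KS.gT mk gx κ Φ t p D) f) : 22000 * Neg.Kq κ * (KS0.R'0 κ Φ t p D mk + 2) ≤ ℓL κ Φ t p D (KS.gT mk gx κ Φ t p D) f := by
  have h1 := (hR0_of_ge h D).2
  have h2 := hN.ℓ_le
  have h1' : ((22000 * Neg.Kq κ * (KS0.R'0 κ Φ t p D mk + 2) : ℕ) : ℤ) ≤ (ML κ Φ t p D (KS.gT mk gx κ Φ t p D) : ℤ) := by exact_mod_cast h1
  have : ((22000 * Neg.Kq κ * (KS0.R'0 κ Φ t p D mk + 2) : ℕ) : ℤ) ≤ (ℓL κ Φ t p D (KS.gT mk gx κ Φ t p D) f : ℕ) := by linarith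
  exact_mod_cast this

/-- **J19 `hnA`**: `2000·Kq·(R′0+2) ≤ n_L g (KS.fT mk fx)` from any width residual dominating `fxC` (EqNumL-free, any box value `g`). [folklore] -/
theorem hnA_of_ge {κ : Consts} {V : Type} [DecidableEq V] [Countable V] {G : SimpleGraph V} [G.LocallyFinite] {Φ : PlanarSkeletonFrmFrom G} {t : V} {p : unitInterval} {mk : ℕ} {fx : Neg.FSlot} (h : ∀ D : DataNS V, fxC mk κ Φ t p D ≤ fx κ Φ t p D) (D : DataNS V) (g : ℕ) :
    2000 * Neg.Kq κ * (KS0.R'0 κ Φ t p D mk + 2) ≤ nL κ Φ t p D g (KS.fT mk fx κ Φ t p D) :=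
  (fxC_floor κ Φ t p D mk).trans ((h D).trans (((KS.fT_floors κ Φ t p D mk fx).2.2.2).trans (n₁L_le_nL κ Φ t p D g _).2))

/-- **J19 `hRn0`**: `R′0 ≤ n_L g (KS.fT mk fx)` (from `hnA`). [folklore] -/
theorem hRn0_of_ge {κ : Consts} {V : Type} [DecidableEq V] [Countable V] {G : SimpleGraph V} [G.LocallyFinite] {Φ : PlanarSkeletonFrmFrom G} {t : V} {p : unitInterval} {mk : ℕ} {fx : Neg.FSlot} (h : ∀ D : DataNS V, fxC mk κ Φ t p D ≤ fx κ Φ t p D) (D : DataNS V) (g : ℕ) :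
    KS0.R'0 κ Φ t p D mk ≤ nL κ Φ t p D g (KS.fT mk fx κ Φ t p D) := by
  have h1 := hnA_of_ge h D g
  have hKq := Neg.one_le_Kq κ
  have : KS0.R'0 κ Φ t p D mk ≤ 2000 * Neg.Kq κ * (KS0.R'0 κ Φ t p D mk + 2) := by nlinarith
  exact this.trans h1

end Transfer

end NegB

end PlanarSkeletonFrmFrom

end Summit.CriticalPhenomena.PercolationContinuityZ3.Theorems.Transplant

end
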